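import Mathlib
import Summits.AnomalousDissipation.AnomalousDissipation.Theses.WazewskiBlock
import Literature.Analysis.FluidPDE.GalerkinFlow
import Literature.Dynamics.ConleyIndex.PolyfacialBlock
import Summits.AnomalousDissipation.AnomalousDissipation.Theorems.WazewskiBlockUniformGalerkinTrapStubBlockToWindow
import Summits.AnomalousDissipation.AnomalousDissipation.Theorems.WazewskiBlockUniformGalerkinTrapStubExitClosedOfTransversal
import HarnessLib

/-!
# Skeleton — crux stmt-AnomalousDissipation-10352 (`WazewskiBlock.UniformGalerkinTrap`), line `SketchIdeator4`
# (idea card `gevrey-tail-lift`), lead prover-line-stmt-AnomalousDissipation-10352-c3-0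

The card's lever (Zgliczyński–Mischaikow self-consistent bounds, read in Ważewski form): a regular polyfacial block
of the Galerkin phase flow whose faces split into LOW faces (`Sum.inl`, a tube around a loud structure in the modes
`|k| ≤ m`) and TAIL faces (`Sum.inr`, an h¹ / Gevrey box of the modes `m < |k| ≤ N`) that are strict ENTRANCE faces;
then the immediate exit set is the low exit set (`exitSet_eq_of_entrance`, the card's lemma of the same name), so
Conley's Ważewski hypothesis only asks that the block does not retract onto its LOW exit set (which, for a product
block, is the level-`m` non-retraction: the card's `not_retract_prod` / `tailLift_exists_forall_mem`).  The block may
be taken relative to a closed forward-invariant set `M` (mean-zero phase vectors, a symmetry class `Fix Γ`).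

Typing decision (lead c3).  The ideator's `SketchIdeator4.lean` is not readable from this seat (gate evidence store
unmounted; crux-dir copy never published), so the skeleton is re-typed from the card's printed signatures in the
vocabulary of `Lines/Sketch.lean`.  The card's Transfer `C⁺` (level-`m` block data + r-uniform tail inequalities) is
not typeable over the tree today (sup-norm strain of the hull, cascade input, Agmon/Gagliardo–Nirenberg on `𝕋³`); what
IS typeable, and what `C⁺` together with the card's own analysis stubs (`stub_tailFaceEntrance_h1`, `stub_levelSplit`,
low-face robustness) would deliver at each level `N > m`, is registered as THE BET `stub_entranceFacedBlocks`:
entrance-faced transversal polyfacial block data, relative to a closed invariant set, inside the coefficient window,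
at every level `N ≥ N₀(ν)`, for every `ν ∈ (0, ν₀]`.  It is weaker than `C⁺` and still sufficient.

Composition (kernel-checked modulo the registered `stub_*`; `UniformGalerkinTrap_of` is the only theorem concluding
the crux by name):

  stub_entranceFacedBlocks (THE BET)
  ⟹ exit set = low exit set (`exitSet_eq_of_entrance`, proved) and it is closed (`stub_exitClosed_of_transversal`,
    landed p108128) ⟹ Ważewski (tree `IsSemiflow.exists_forall_mem_of_not_retract`) ⟹ a phase point trapped in the
    block ⊆ coefficient window ⟹ `stub_blockToWindow` (landed) ⟹ a Galerkin mode whose `Torus.galerkinFlow` orbit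
    stays in the window ⟹ `IsGalerkinMode.galerkinFlow_clauses` ⟹ the crux.
-/

noncomputable section

-- `Summit.<Summit>.<Problem>` is the mandated summit-side namespace (CONVENTIONS §2); deliberate duplicate.
set_option linter.dupNamespace false

namespace Summit.AnomalousDissipation.AnomalousDissipation.Cruxes.UniformGalerkinTrap.SketchIdeator4

open scoped InnerProductSpace ENNReal NNReal
open MeasureTheory Set Filter Topology
open Literature.Analysis.FunctionSpaces Literature.Analysis.FunctionSpaces.Torus
open Literature.Analysis.FluidPDE
open Literature.Dynamics.ConleyIndex
open Summit.AnomalousDissipation.AnomalousDissipation.Theorems.UniformGalerkinTrap.Sketch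
  (stub_blockToWindow stub_exitClosed_of_transversal)

/-! ## §1 Registered stub — THE BET

Written WITHOUT local notations and without named arguments (`(d := Fin 3)` is spelled as the ascription
`(freqBall N : Finset (Fin 3 → ℤ))`), so that the registered text re-elaborates verbatim in a `Theorems/` file that
opens the same namespaces. -/

/-- **stub (THE BET, `EntranceFacedBlocks`).** A mean-zero vector trigonometric-polynomial force `f` and window
constants `E, ε₀, ν₀ > 0` such that for every `0 < ν ≤ ν₀` there are a cap `G` and an order `N₀` such that every level
`N ≥ N₀` carries: finitely many continuous faces `h` on the Galerkin phase space of order `N`, split into low faces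
(`Sum.inl`) and tail faces (`Sum.inr`), with continuous flow-derivatives `d` along `galerkinPhaseFlow`; a closed
forward-invariant set `M`; transversality of the active faces on the block `faceSet h ∩ M`; strict ENTRANCE through
every active tail face; NO retraction of the block onto its low exit set; and the block inside the coefficient window
`{½∑‖c k‖² ≤ E, ∑ Re⟪f̂ k, c k⟫ ≥ ε₀, 4π²∑|k|²‖c k‖² ≤ G}`.  (Card `gevrey-tail-lift`, Transfer `C⁺` composed with its
tail-entrance / level-split / low-face-robustness stubs; ZM2001 Def 2.11 C4a–C5, Thm 2.12, Cor 2.15.) -/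
theorem stub_entranceFacedBlocks :
    ∃ (m : ℕ) (f : UnitAddTorus (Fin 3) → EuclideanSpace ℝ (Fin 3)),
      ((IsSmooth f ∧ IsDivFree f ∧ ∀ k : Fin 3 → ℤ, ((m : ℕ) : ℝ) ^ 2 < freqNormSq k →
        UnitAddTorus.mFourierCoeff (EuclideanSpace.complexify ∘ f) k = 0) ∧ HasZeroMean f) ∧
      ∃ (E ε₀ ν₀ : ℝ), 0 < ε₀ ∧ 0 < ν₀ ∧
        ∀ ν : ℝ, 0 < ν → ν ≤ ν₀ → ∃ (G : ℝ≥0) (N₀ : ℕ), ∀ N : ℕ, N₀ ≤ N →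
          ∃ (n₁ n₂ : ℕ)
            (h d : Fin n₁ ⊕ Fin n₂ → ↥(galerkinSubspace (freqBall N : Finset (Fin 3 → ℤ))) → ℝ)
            (M : Set ↥(galerkinSubspace (freqBall N : Finset (Fin 3 → ℤ)))),
            (∀ i, Continuous (h i)) ∧ (∀ i, Continuous (d i)) ∧
            (∀ i x t, 0 < t → HasDerivAt
              (fun s => h i (galerkinPhaseFlow ν (fourierRestrict (freqBall N : Finset (Fin 3 → ℤ)) f) s x))
              (d i (galerkinPhaseFlow ν (fourierRestrict (freqBall N : Finset (Fin 3 → ℤ)) f) t x)) t) ∧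
            IsClosed M ∧
            (∀ x ∈ M, ∀ t : ℝ, 0 ≤ t →
              galerkinPhaseFlow ν (fourierRestrict (freqBall N : Finset (Fin 3 → ℤ)) f) t x ∈ M) ∧
            (∀ x ∈ faceSet h ∩ M, ∀ i, h i x = 0 → d i x ≠ 0) ∧
            (∀ x ∈ faceSet h ∩ M, ∀ j : Fin n₂, h (Sum.inr j) x = 0 → 0 < d (Sum.inr j) x) ∧
            (¬ ∃ r : ↥(galerkinSubspace (freqBall N : Finset (Fin 3 → ℤ))) →
                  ↥(galerkinSubspace (freqBall N : Finset (Fin 3 → ℤ))),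
                ContinuousOn r (faceSet h ∩ M) ∧
                MapsTo r (faceSet h ∩ M)
                  {x | x ∈ faceSet h ∩ M ∧ ∃ i : Fin n₁, h (Sum.inl i) x = 0 ∧ d (Sum.inl i) x < 0} ∧
                ∀ x ∈ {x | x ∈ faceSet h ∩ M ∧ ∃ i : Fin n₁, h (Sum.inl i) x = 0 ∧ d (Sum.inl i) x < 0},
                  r x = x) ∧
            faceSet h ∩ M ⊆ {x |
              2⁻¹ * ∑ k, ‖(x : ↥(freqBall N : Finset (Fin 3 → ℤ)) → EuclideanSpace ℂ (Fin 3)) k‖ ^ 2 ≤ E ∧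
              ε₀ ≤ ∑ k, (inner ℂ (fourierRestrict (freqBall N : Finset (Fin 3 → ℤ)) f k)
                ((x : ↥(freqBall N : Finset (Fin 3 → ℤ)) → EuclideanSpace ℂ (Fin 3)) k)).re ∧
              4 * Real.pi ^ 2 * ∑ k, freqNormSq ((k : ↥(freqBall N : Finset (Fin 3 → ℤ))) : Fin 3 → ℤ) *
                ‖(x : ↥(freqBall N : Finset (Fin 3 → ℤ)) → EuclideanSpace ℂ (Fin 3)) k‖ ^ 2 ≤ (G : ℝ)} := by
  sorry

/-! ## §2 Proved plumbing -/

/-- **Exit set under entrance faces** (the card's `exitSet_eq_of_entrance`): if every active tail face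
(`Sum.inr`) is a strict entrance face on `B`, the first-order exit set `{x ∈ B | ∃ i, h i x = 0 ∧ d i x < 0}` is the
LOW exit set `{x ∈ B | ∃ i, h (inl i) x = 0 ∧ d (inl i) x < 0}`. [folklore] -/
theorem exitSet_eq_of_entrance {X : Type*} {ι₁ ι₂ : Type*} {h d : ι₁ ⊕ ι₂ → X → ℝ} {B : Set X}
    (hent : ∀ x ∈ B, ∀ j : ι₂, h (Sum.inr j) x = 0 → 0 < d (Sum.inr j) x) :
    {x | x ∈ B ∧ ∃ i, h i x = 0 ∧ d i x < 0} =
      {x | x ∈ B ∧ ∃ i : ι₁, h (Sum.inl i) x = 0 ∧ d (Sum.inl i) x < 0} := by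
  ext x
  simp only [mem_setOf_eq]
  constructor
  · rintro ⟨hxB, i, hi, hdi⟩
    refine ⟨hxB, ?_⟩
    rcases i with i | j
    · exact ⟨i, hi, hdi⟩
    · exact absurd hdi (not_lt.2 (hent x hxB j hi).le)
  · rintro ⟨hxB, i, hi, hdi⟩
    exact ⟨hxB, Sum.inl i, hi, hdi⟩

/-- The Galerkin phase flow of order `N` is a continuous semiflow (`ν ≥ 0`, `f` integrable). [folklore] -/
theorem isSemiflow_phaseFlow {ν : ℝ} (hν : 0 ≤ ν) {f : UnitAddTorus (Fin 3) → EuclideanSpace ℝ (Fin 3)}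
    (hf : Integrable f volume) (N : ℕ) :
    IsSemiflow (galerkinPhaseFlow ν (fourierRestrict (freqBall (d := Fin 3) N) f)) := by
  obtain ⟨h1, h2, h3⟩ := galerkinPhaseFlow_semiflow (S := freqBall (d := Fin 3) N) hν
    neg_mem_freqBall_of_mem (isRealCoeff_mFourierCoeff (S := freqBall (d := Fin 3) N) hf) (ν := ν)
  exact ⟨h1, h2, h3⟩

/-! ## §3 Composition: the registered stub proves the crux BY NAME -/

/-- **Composition of the line `SketchIdeator4`** — the only theorem of the file concluding the crux, unconditionally
modulo the registered bet: at every `(ν, N)` the bet's entrance-faced transversal block `B = faceSet h ∩ M` has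
immediate exit set equal to its LOW exit set (`stub_exitClosed_of_transversal` + `exitSet_eq_of_entrance`), closed;
the bet's non-retraction onto the low exit set is then Conley's Ważewski hypothesis, so the tree engine
`IsSemiflow.exists_forall_mem_of_not_retract` traps a phase point in `B ⊆` coefficient window for all `t ≥ 0`;
`stub_blockToWindow` turns it into a Galerkin mode whose `Torus.galerkinFlow` orbit stays in the window, and
`IsGalerkinMode.galerkinFlow_clauses` supplies the crux's clause block. -/
theorem UniformGalerkinTrap_of : Theses.WazewskiBlock.UniformGalerkinTrap := by
  obtain ⟨m, f, hf, E, ε₀, ν₀, hε₀, hν₀, hall⟩ := stub_entranceFacedBlocks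
  refine ⟨m, f, hf.1, hf.2, E, ε₀, ν₀, hε₀, hν₀, fun ν hν hνle => ?_⟩
  obtain ⟨G, N₀, hN⟩ := hall ν hν hνle
  refine ⟨G, N₀, fun N hN₀ => ?_⟩
  obtain ⟨n₁, n₂, h, d, M, hh, hd, hder, hM, hinv, htrans, hent, hnr, hwin⟩ := hN N hN₀
  have hfi : Integrable f volume := hf.1.1.continuous.integrable_unitAddTorus
  have hf2 : MemLp f 2 volume := hf.1.1.memLp 2
  have hsf : IsSemiflow (galerkinPhaseFlow ν (fourierRestrict (freqBall (d := Fin 3) N) f)) :=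
    isSemiflow_phaseFlow hν.le hfi N
  -- the exit set of the block: explicit, low faces only, closed
  obtain ⟨heq, hclosed⟩ := stub_exitClosed_of_transversal
    (galerkinPhaseFlow ν (fourierRestrict (freqBall (d := Fin 3) N) f)) h d M hsf hh hd hder hM hinv htrans
  have hlow := exitSet_eq_of_entrance (h := h) (d := d) (B := faceSet h ∩ M) hent
  have hB : IsClosed (faceSet h ∩ M) := (isClosed_faceSet hh).inter hM
  have hnr' : ¬ ∃ r : ↥(galerkinSubspace (freqBall (d := Fin 3) N)) → ↥(galerkinSubspace (freqBall (d := Fin 3) N)),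
      ContinuousOn r (faceSet h ∩ M) ∧
      MapsTo r (faceSet h ∩ M)
        (immediateExitSet (galerkinPhaseFlow ν (fourierRestrict (freqBall (d := Fin 3) N) f)) (faceSet h ∩ M)) ∧
      ∀ x ∈ immediateExitSet (galerkinPhaseFlow ν (fourierRestrict (freqBall (d := Fin 3) N) f)) (faceSet h ∩ M),
        r x = x := by
    rw [heq, hlow]
    exact hnr
  -- Ważewski: a phase point trapped in the block
  obtain ⟨x, hx, htrap⟩ := hsf.exists_forall_mem_of_not_retract hB hclosed hnr'
  -- block ⊆ coefficient window ⟹ field orbit in the window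
  obtain ⟨hmode, hwin'⟩ := stub_blockToWindow ν N f E ε₀ G x hν.le hf2 (fun t ht => hwin (htrap t ht))
  obtain ⟨-, hcont, hslice, htest, henergy⟩ := hmode.galerkinFlow_clauses (ν := ν) hν.le hf2
  exact ⟨fun t => Torus.galerkinFlow ν f N t (realTrigPoly (freqBall (d := Fin 3) N)
      (coeffExt (freqBall (d := Fin 3) N) (x : ↥(freqBall (d := Fin 3) N) → EuclideanSpace ℂ (Fin 3)))),
    ⟨hcont, fun t ht => hslice t ht, fun b hb s t hs hst => htest b hb s t hs hst, henergy⟩, hwin'⟩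

end Summit.AnomalousDissipation.AnomalousDissipation.Cruxes.UniformGalerkinTrap.SketchIdeator4

end
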